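import Summits.RiemannHypothesis.RiemannHypothesis.Theorems.EtaLeadingQuarterWeakLockingLayerEstimates

/-!
# The locking layer with the Euler (halved) ending, I: exponential bookkeeping
(route EtaTailTrialBound, item `LockingLayer`, stmt-RiemannHypothesis-21599 — RH-free support file)

Pure real inequalities in `L = log M ≥ 150`, the width `s = s_M ≥ 1` and the mass
`D = D_M ≥ s e^{271L/300}` of the Gaussian log-scale layer
(`EtaLeadingQuarterWeakLockingLayerConstruction/Estimates.lean`): each of the four terms of the
fixed-`M` three-range bound `EtaLeadingQuarter.Locking.zeroSide_le` (`X = e^{37L/50}`, `T₂ = e^{6L/5}`),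
multiplied by the strong-twin normalisation `e^{L} · (9/4)/D²` (`M = e^{L}`, amplitude
`A'_M² ≤ (9/4)/D²`), is at most a constant times the common rate `L³ e^{−L/15}`:
term 1 (Gaussian decay at the low zeros) `≤ 365 Z₀ ·`, term 2 (Euler–Maclaurin error × `N(X)`)
`≤ 729 ·`, term 3 (middle range) `≤ 432 A ·`, term 4 (tail) `≤ 1 ·`; and the energy normalisation
`L · (9/4)/D ≤ (9/4) L³ e^{−L/15}`. Part II (`EtaTailTrialBoundLockingLayer.lean`) feeds the layer in.
RH is not proved by this file and nothing here bears on the truth of RH.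
-/

noncomputable section

open Complex MeasureTheory Set Filter Finset intervalIntegral
open scoped Real Topology ComplexConjugate

set_option linter.dupNamespace false  -- the mandated namespace repeats `RiemannHypothesis`

namespace Summit.RiemannHypothesis.RiemannHypothesis.Theorems.EtaTailTrialBound.Locking

open Literature.NumberTheory.LFunctions NicolasJExplicit SchoenfeldBound ZetaZeroTails
open Summit.RiemannHypothesis.RiemannHypothesis.Theorems.EtaLeadingQuarter.ZeroSide
open Summit.RiemannHypothesis.RiemannHypothesis.Theorems.EtaLeadingQuarter.Locking

/-! ## The common rate and the four terms -/

/-- `e^{−cL} ≤ L³ e^{−L/15}` for `L ≥ 1`, `c ≥ 1/15`. [folklore] -/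
theorem exp_neg_le_rate {L c : ℝ} (hL : 1 ≤ L) (hc : 1 / 15 ≤ c) :
    Real.exp (-(c * L)) ≤ L ^ 3 * Real.exp (-(L / 15)) := by
  have h1 : Real.exp (-(c * L)) ≤ Real.exp (-(L / 15)) := Real.exp_le_exp.2 (by nlinarith)
  have h2 : (1 : ℝ) ≤ L ^ 3 := one_le_pow₀ hL
  nlinarith [Real.exp_pos (-(L / 15))]

/-- `L e^{−cL} ≤ L³ e^{−L/15}` for `L ≥ 1`, `c ≥ 1/15`. [folklore] -/
theorem mul_exp_neg_le_rate {L c : ℝ} (hL : 1 ≤ L) (hc : 1 / 15 ≤ c) :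
    L * Real.exp (-(c * L)) ≤ L ^ 3 * Real.exp (-(L / 15)) := by
  have h1 : Real.exp (-(c * L)) ≤ Real.exp (-(L / 15)) := Real.exp_le_exp.2 (by nlinarith)
  have h2 : L ≤ L ^ 3 := by nlinarith [one_le_pow₀ (n := 2) hL]
  have h3 : 0 ≤ L := by linarith
  calc L * Real.exp (-(c * L)) ≤ L * Real.exp (-(L / 15)) := mul_le_mul_of_nonneg_left h1 h3
    _ ≤ L ^ 3 * Real.exp (-(L / 15)) := mul_le_mul_of_nonneg_right h2 (Real.exp_pos _).le

/-- `D² ≥ s² e^{542L/300}` from `D ≥ s e^{271L/300}` (`s ≥ 0`). [folklore] -/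
theorem mass_sq_ge {L s D : ℝ} (hs : 0 ≤ s) (hD : s * Real.exp (271 / 300 * L) ≤ D) :
    s ^ 2 * Real.exp (271 / 300 * L) ^ 2 ≤ D ^ 2 := by
  have h0 : 0 ≤ s * Real.exp (271 / 300 * L) := by positivity
  calc s ^ 2 * Real.exp (271 / 300 * L) ^ 2 = (s * Real.exp (271 / 300 * L)) ^ 2 := by ring
    _ ≤ D ^ 2 := pow_le_pow_left₀ h0 hD 2

/-- **Term 1 (low zeros, Gaussian decay)**:
`e^{L}(9/4)D^{-2} · 2α²Z₀ ≤ 365 Z₀ · L³e^{−L/15}`, `α = (√(2π)s + 1)e^{L/4} + 1 + 2√π`. [folklore] -/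
theorem term1_le {L s D Z : ℝ} (hL : 150 ≤ L) (hs : 1 ≤ s)
    (hD : s * Real.exp (271 / 300 * L) ≤ D) (hZ : 0 ≤ Z) :
    Real.exp L * ((9 / 4) / D ^ 2) *
        (2 * ((Real.sqrt (2 * π) * s + 1) * Real.exp (L / 4) + 1 + 2 * Real.sqrt π) ^ 2 * Z) ≤
      365 * Z * (L ^ 3 * Real.exp (-(L / 15))) := by
  obtain ⟨-, h3, hπ2⟩ := sqrt_two_pi_bounds
  have hs0 : 0 ≤ s := by linarith
  have hD0 : 0 < D := lt_of_lt_of_le (by positivity) hD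
  have he4 : 1 ≤ Real.exp (L / 4) := Real.one_le_exp (by linarith)
  have hsq0 : 0 ≤ Real.sqrt (2 * π) := Real.sqrt_nonneg _
  have hsq1 : 0 ≤ Real.sqrt π := Real.sqrt_nonneg _
  set α := (Real.sqrt (2 * π) * s + 1) * Real.exp (L / 4) + 1 + 2 * Real.sqrt π with hα_def
  have hα0 : 0 ≤ α := by positivity
  have hα : α ≤ 9 * s * Real.exp (L / 4) := by
    have h1 : Real.sqrt (2 * π) * s + 1 ≤ 4 * s := by nlinarith
    have h2 : 1 + 2 * Real.sqrt π ≤ 5 * (s * Real.exp (L / 4)) := by nlinarith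
    have h3 : (Real.sqrt (2 * π) * s + 1) * Real.exp (L / 4) ≤ 4 * s * Real.exp (L / 4) :=
      mul_le_mul_of_nonneg_right h1 (by positivity)
    rw [hα_def]
    linarith
  have e : Real.exp (L / 4) * Real.exp (L / 4) = Real.exp (L / 2) := by
    rw [← Real.exp_add]; congr 1; ring
  have hα2 : α ^ 2 ≤ 81 * (s ^ 2 * Real.exp (L / 2)) := by
    calc α ^ 2 ≤ (9 * s * Real.exp (L / 4)) ^ 2 := pow_le_pow_left₀ hα0 hα 2
      _ = 81 * (s ^ 2 * (Real.exp (L / 4) * Real.exp (L / 4))) := by ring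
      _ = 81 * (s ^ 2 * Real.exp (L / 2)) := by rw [e]
  have e1 : Real.exp (L / 2) * Real.exp L =
      Real.exp (-(92 / 300 * L)) * Real.exp (271 / 300 * L) ^ 2 := by
    rw [sq, ← Real.exp_add, ← Real.exp_add, ← Real.exp_add]; congr 1; ring
  have hkey : s ^ 2 * Real.exp (L / 2) * Real.exp L ≤ Real.exp (-(92 / 300 * L)) * D ^ 2 := by
    calc s ^ 2 * Real.exp (L / 2) * Real.exp L
        = Real.exp (-(92 / 300 * L)) * (s ^ 2 * Real.exp (271 / 300 * L) ^ 2) := by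
          rw [mul_assoc, e1]; ring
      _ ≤ Real.exp (-(92 / 300 * L)) * D ^ 2 :=
          mul_le_mul_of_nonneg_left (mass_sq_ge hs0 hD) (Real.exp_pos _).le
  have hkey' : s ^ 2 * Real.exp (L / 2) * Real.exp L / D ^ 2 ≤ Real.exp (-(92 / 300 * L)) := by
    rw [div_le_iff₀ (by positivity)]; exact hkey
  have hrate : Real.exp (-(92 / 300 * L)) ≤ L ^ 3 * Real.exp (-(L / 15)) :=
    exp_neg_le_rate (by linarith) (by norm_num)
  have hr0 : 0 ≤ L ^ 3 * Real.exp (-(L / 15)) := by positivity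
  calc Real.exp L * ((9 / 4) / D ^ 2) * (2 * α ^ 2 * Z)
      = (9 / 2) * Z * (α ^ 2 * (Real.exp L / D ^ 2)) := by ring
    _ ≤ (9 / 2) * Z * (81 * (s ^ 2 * Real.exp (L / 2)) * (Real.exp L / D ^ 2)) :=
        mul_le_mul_of_nonneg_left (mul_le_mul_of_nonneg_right hα2 (by positivity)) (by positivity)
    _ = (9 / 2) * 81 * Z * (s ^ 2 * Real.exp (L / 2) * Real.exp L / D ^ 2) := by ring
    _ ≤ (9 / 2) * 81 * Z * Real.exp (-(92 / 300 * L)) :=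
        mul_le_mul_of_nonneg_left hkey' (by positivity)
    _ ≤ (9 / 2) * 81 * Z * (L ^ 3 * Real.exp (-(L / 15))) :=
        mul_le_mul_of_nonneg_left hrate (by positivity)
    _ ≤ 365 * Z * (L ^ 3 * Real.exp (-(L / 15))) := by nlinarith [mul_nonneg hZ hr0]

/-- **Term 2 (low zeros, Euler–Maclaurin error × count)**:
`e^{L}(9/4)D^{-2} · 4β²·9L e^{37L/50} ≤ 729 · L³e^{−L/15}`, `β = √(2π)s`. [folklore] -/
theorem term2_le {L s D : ℝ} (hL : 150 ≤ L) (hs : 1 ≤ s)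
    (hD : s * Real.exp (271 / 300 * L) ≤ D) :
    Real.exp L * ((9 / 4) / D ^ 2) *
        (4 * (Real.sqrt (2 * π) * s) ^ 2 * (9 * L * Real.exp (37 / 50 * L))) ≤
      729 * (L ^ 3 * Real.exp (-(L / 15))) := by
  have hs0 : 0 ≤ s := by linarith
  have hL0 : 0 ≤ L := by linarith
  have hD0 : 0 < D := lt_of_lt_of_le (by positivity) hD
  have hπ := Real.pi_lt_four
  have hβ2 : (Real.sqrt (2 * π) * s) ^ 2 ≤ 8 * s ^ 2 := by
    rw [mul_pow, Real.sq_sqrt (by positivity)]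
    nlinarith [sq_nonneg s]
  have e1 : Real.exp (37 / 50 * L) * Real.exp L =
      Real.exp (-(1 / 15 * L)) * Real.exp (271 / 300 * L) ^ 2 := by
    rw [sq, ← Real.exp_add, ← Real.exp_add, ← Real.exp_add]; congr 1; ring
  have hkey : s ^ 2 * Real.exp (37 / 50 * L) * Real.exp L ≤ Real.exp (-(1 / 15 * L)) * D ^ 2 := by
    calc s ^ 2 * Real.exp (37 / 50 * L) * Real.exp L
        = Real.exp (-(1 / 15 * L)) * (s ^ 2 * Real.exp (271 / 300 * L) ^ 2) := by
          rw [mul_assoc, e1]; ring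
      _ ≤ Real.exp (-(1 / 15 * L)) * D ^ 2 :=
          mul_le_mul_of_nonneg_left (mass_sq_ge hs0 hD) (Real.exp_pos _).le
  have hkey' : s ^ 2 * Real.exp (37 / 50 * L) * Real.exp L / D ^ 2 ≤ Real.exp (-(1 / 15 * L)) := by
    rw [div_le_iff₀ (by positivity)]; exact hkey
  have hrate : L * Real.exp (-(1 / 15 * L)) ≤ L ^ 3 * Real.exp (-(L / 15)) :=
    mul_exp_neg_le_rate (by linarith) (by norm_num)
  calc Real.exp L * ((9 / 4) / D ^ 2) * (4 * (Real.sqrt (2 * π) * s) ^ 2 * (9 * L * Real.exp (37 / 50 * L)))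
      = 81 * L * ((Real.sqrt (2 * π) * s) ^ 2 * (Real.exp (37 / 50 * L) * Real.exp L / D ^ 2)) := by
        ring
    _ ≤ 81 * L * (8 * s ^ 2 * (Real.exp (37 / 50 * L) * Real.exp L / D ^ 2)) :=
        mul_le_mul_of_nonneg_left (mul_le_mul_of_nonneg_right hβ2 (by positivity)) (by positivity)
    _ = 648 * (L * (s ^ 2 * Real.exp (37 / 50 * L) * Real.exp L / D ^ 2)) := by ring
    _ ≤ 648 * (L * Real.exp (-(1 / 15 * L))) :=
        mul_le_mul_of_nonneg_left (mul_le_mul_of_nonneg_left hkey' hL0) (by norm_num)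
    _ ≤ 648 * (L ^ 3 * Real.exp (-(L / 15))) := mul_le_mul_of_nonneg_left hrate (by norm_num)
    _ ≤ 729 * (L ^ 3 * Real.exp (-(L / 15))) := by nlinarith [Real.exp_pos (-(L / 15)), pow_nonneg hL0 3]

/-- **Term 3 (middle range: Gallagher cells, local density, mean values)**:
`e^{L}(9/4)D^{-2} · 2X^{-2}·2A log(T₂+4)·(5(T₂+1)+18e^{L})·(3/2+L²/2)·D ≤ 432A · L³e^{−L/15}`
(`X = e^{37L/50}`, `T₂ = e^{6L/5}`). [folklore] -/
theorem term3_le {L s D A : ℝ} (hL : 150 ≤ L) (hs : 1 ≤ s)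
    (hD : s * Real.exp (271 / 300 * L) ≤ D) (hA0 : 0 ≤ A) :
    Real.exp L * ((9 / 4) / D ^ 2) *
        (2 * (Real.exp (37 / 50 * L) ^ 2)⁻¹ * (2 * A * Real.log (Real.exp (6 / 5 * L) + 4)) *
          ((5 * (Real.exp (6 / 5 * L) + 1) + 18 * Real.exp L) * ((3 / 2 + L ^ 2 / 2) * D))) ≤
      432 * A * (L ^ 3 * Real.exp (-(L / 15))) := by
  have hs0 : 0 ≤ s := by linarith
  have hL0 : 0 ≤ L := by linarith
  have hE0 : 0 < Real.exp (271 / 300 * L) := Real.exp_pos _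
  have hD1 : Real.exp (271 / 300 * L) ≤ D := le_trans (le_mul_of_one_le_left hE0.le hs) hD
  have hD0 : 0 < D := lt_of_lt_of_le hE0 hD1
  set T₂ := Real.exp (6 / 5 * L) with hT₂
  set X := Real.exp (37 / 50 * L) with hX
  have hT0 : 0 < T₂ := Real.exp_pos _
  have hX0 : 0 < X := Real.exp_pos _
  have hT2516 : 2516 ≤ T₂ := exp_eight_ge.trans (Real.exp_le_exp.2 (by linarith))
  -- `log(T₂ + 4) ≤ 2L`
  have hlog : Real.log (T₂ + 4) ≤ 2 * L := by
    rw [Real.log_le_iff_le_exp (by positivity)]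
    have e : Real.exp (2 * L) = T₂ * Real.exp (4 / 5 * L) := by
      rw [hT₂, ← Real.exp_add]; congr 1; ring
    have h1 : 4 / 5 * L + 1 ≤ Real.exp (4 / 5 * L) := Real.add_one_le_exp _
    rw [e]
    nlinarith
  have hlog0 : 0 ≤ Real.log (T₂ + 4) := Real.log_nonneg (by linarith)
  -- `5(T₂+1) + 18 e^{L} ≤ 24 T₂`
  have hM : Real.exp L ≤ T₂ := Real.exp_le_exp.2 (by linarith)
  have h24 : 5 * (T₂ + 1) + 18 * Real.exp L ≤ 24 * T₂ := by linarith
  have h240 : 0 ≤ 5 * (T₂ + 1) + 18 * Real.exp L := by positivity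
  -- `3/2 + L²/2 ≤ L²`
  have hL2 : 3 / 2 + L ^ 2 / 2 ≤ L ^ 2 := by nlinarith
  -- the bracket
  have hbr : 2 * (X ^ 2)⁻¹ * (2 * A * Real.log (T₂ + 4)) *
      ((5 * (T₂ + 1) + 18 * Real.exp L) * ((3 / 2 + L ^ 2 / 2) * D)) ≤
      2 * (X ^ 2)⁻¹ * (2 * A * (2 * L)) * ((24 * T₂) * (L ^ 2 * D)) := by
    have i1 : 2 * (X ^ 2)⁻¹ * (2 * A * Real.log (T₂ + 4)) ≤ 2 * (X ^ 2)⁻¹ * (2 * A * (2 * L)) :=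
      mul_le_mul_of_nonneg_left (mul_le_mul_of_nonneg_left hlog (by positivity)) (by positivity)
    have i2 : (5 * (T₂ + 1) + 18 * Real.exp L) * ((3 / 2 + L ^ 2 / 2) * D) ≤
        (24 * T₂) * (L ^ 2 * D) :=
      mul_le_mul h24 (mul_le_mul_of_nonneg_right hL2 hD0.le) (by positivity) (by positivity)
    exact mul_le_mul i1 i2 (by positivity) (by positivity)
  -- the exponentials: `e^{L} T₂ X^{-2} / D ≤ e^{−55L/300}`
  have e1 : Real.exp L * T₂ = Real.exp (216 / 300 * L) * X ^ 2 := by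
    rw [hT₂, hX, sq, ← Real.exp_add, ← Real.exp_add, ← Real.exp_add]; congr 1; ring
  have e2 : Real.exp (216 / 300 * L) = Real.exp (-(55 / 300 * L)) * Real.exp (271 / 300 * L) := by
    rw [← Real.exp_add]; congr 1; ring
  have hkey : Real.exp L * T₂ * (X ^ 2)⁻¹ / D ≤ Real.exp (-(55 / 300 * L)) := by
    have h1 : Real.exp L * T₂ * (X ^ 2)⁻¹ = Real.exp (216 / 300 * L) := by
      rw [e1, mul_assoc, mul_inv_cancel₀ (by positivity), mul_one]
    rw [h1, div_le_iff₀ hD0, e2]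
    exact mul_le_mul_of_nonneg_left hD1 (Real.exp_pos _).le
  have hrate : Real.exp (-(55 / 300 * L)) ≤ Real.exp (-(L / 15)) := Real.exp_le_exp.2 (by linarith)
  have hF0 : 0 ≤ Real.exp L * ((9 / 4) / D ^ 2) := by positivity
  calc Real.exp L * ((9 / 4) / D ^ 2) * (2 * (X ^ 2)⁻¹ * (2 * A * Real.log (T₂ + 4)) *
          ((5 * (T₂ + 1) + 18 * Real.exp L) * ((3 / 2 + L ^ 2 / 2) * D)))
      ≤ Real.exp L * ((9 / 4) / D ^ 2) * (2 * (X ^ 2)⁻¹ * (2 * A * (2 * L)) * ((24 * T₂) * (L ^ 2 * D))) :=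
        mul_le_mul_of_nonneg_left hbr hF0
    _ = 432 * A * L ^ 3 * (Real.exp L * T₂ * (X ^ 2)⁻¹ / D) := by
        field_simp
        ring
    _ ≤ 432 * A * L ^ 3 * Real.exp (-(55 / 300 * L)) :=
        mul_le_mul_of_nonneg_left hkey (by positivity)
    _ ≤ 432 * A * L ^ 3 * Real.exp (-(L / 15)) :=
        mul_le_mul_of_nonneg_left hrate (by positivity)
    _ = 432 * A * (L ^ 3 * Real.exp (-(L / 15))) := by ring

/-- **Term 4 (tail `|γ| > T₂`)**: `e^{L}(9/4)D^{-2} · D²·0.34(6L/5)/T₂ ≤ L³e^{−L/15}`. [folklore] -/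
theorem term4_le {L s D : ℝ} (hL : 150 ≤ L) (hs : 1 ≤ s)
    (hD : s * Real.exp (271 / 300 * L) ≤ D) :
    Real.exp L * ((9 / 4) / D ^ 2) * (D ^ 2 * (0.34 * (6 / 5 * L) / Real.exp (6 / 5 * L))) ≤
      L ^ 3 * Real.exp (-(L / 15)) := by
  have hs0 : 0 ≤ s := by linarith
  have hL0 : 0 ≤ L := by linarith
  have hD0 : 0 < D := lt_of_lt_of_le (by positivity) hD
  have e1 : Real.exp L / Real.exp (6 / 5 * L) = Real.exp (-(1 / 5 * L)) := by
    rw [← Real.exp_sub]; congr 1; ring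
  have hrate : L * Real.exp (-(1 / 5 * L)) ≤ L ^ 3 * Real.exp (-(L / 15)) :=
    mul_exp_neg_le_rate (by linarith) (by norm_num)
  calc Real.exp L * ((9 / 4) / D ^ 2) * (D ^ 2 * (0.34 * (6 / 5 * L) / Real.exp (6 / 5 * L)))
      = (9 / 4 * 0.34 * (6 / 5)) * (L * (Real.exp L / Real.exp (6 / 5 * L))) := by
        field_simp
    _ = (9 / 4 * 0.34 * (6 / 5)) * (L * Real.exp (-(1 / 5 * L))) := by rw [e1]
    _ ≤ 1 * (L * Real.exp (-(1 / 5 * L))) :=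
        mul_le_mul_of_nonneg_right (by norm_num) (by positivity)
    _ ≤ L ^ 3 * Real.exp (-(L / 15)) := by rw [one_mul]; exact hrate

/-- **Energy rate**: `L · (9/4)/D ≤ (9/4) · L³e^{−L/15}` (`D ≥ s e^{271L/300} ≥ e^{271L/300}`).
[folklore] -/
theorem energy_rate {L s D : ℝ} (hL : 150 ≤ L) (hs : 1 ≤ s)
    (hD : s * Real.exp (271 / 300 * L) ≤ D) :
    L * ((9 / 4) / D) ≤ (9 / 4) * (L ^ 3 * Real.exp (-(L / 15))) := by
  have hL0 : 0 ≤ L := by linarith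
  have hE0 : 0 < Real.exp (271 / 300 * L) := Real.exp_pos _
  have hD1 : Real.exp (271 / 300 * L) ≤ D := le_trans (le_mul_of_one_le_left hE0.le hs) hD
  have hD0 : 0 < D := lt_of_lt_of_le hE0 hD1
  have hinv : 1 / D ≤ Real.exp (-(271 / 300 * L)) := by
    rw [Real.exp_neg, ← one_div]
    exact one_div_le_one_div_of_le hE0 hD1
  have hrate : L * Real.exp (-(271 / 300 * L)) ≤ L ^ 3 * Real.exp (-(L / 15)) :=
    mul_exp_neg_le_rate (by linarith) (by norm_num)
  calc L * ((9 / 4) / D) = (9 / 4) * (L * (1 / D)) := by ring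
    _ ≤ (9 / 4) * (L * Real.exp (-(271 / 300 * L))) :=
        mul_le_mul_of_nonneg_left (mul_le_mul_of_nonneg_left hinv hL0) (by norm_num)
    _ ≤ (9 / 4) * (L ^ 3 * Real.exp (-(L / 15))) := mul_le_mul_of_nonneg_left hrate (by norm_num)

/-- Bookkeeping: four term bounds and `a ≤ f`, `T ≤ B₁ + B₂ + B₃ + B₄` give the master bound.
[folklore] -/
theorem master_of_terms {m a f T B₁ B₂ B₃ B₄ r₁ r₂ r₃ r₄ : ℝ} (hm : 0 ≤ m) (ha0 : 0 ≤ a)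
    (haf : a ≤ f) (hT0 : 0 ≤ T) (hB : T ≤ B₁ + B₂ + B₃ + B₄)
    (h1 : m * f * B₁ ≤ r₁) (h2 : m * f * B₂ ≤ r₂) (h3 : m * f * B₃ ≤ r₃) (h4 : m * f * B₄ ≤ r₄) :
    m * (a * T) ≤ r₁ + r₂ + r₃ + r₄ := by
  have h : m * (a * T) ≤ m * (f * (B₁ + B₂ + B₃ + B₄)) :=
    mul_le_mul_of_nonneg_left (mul_le_mul haf hB hT0 (ha0.trans haf)) hm
  have e : m * (f * (B₁ + B₂ + B₃ + B₄)) = m * f * B₁ + m * f * B₂ + m * f * B₃ + m * f * B₄ := by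
    ring
  linarith

end Summit.RiemannHypothesis.RiemannHypothesis.Theorems.EtaTailTrialBound.Locking

end
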